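import Summits.AnomalousDissipation.AnomalousDissipation.Theses.QuarticLadder
import Summits.AnomalousDissipation.AnomalousDissipation.Theses.MomentParity
import Summits.AnomalousDissipation.AnomalousDissipation.Theorems.QuarticGate.Negative.LevelCeiling
import Summits.AnomalousDissipation.AnomalousDissipation.Theorems.QuarticGate.Negative.EnergyRow
import Summits.AnomalousDissipation.AnomalousDissipation.Theorems.QuarticGate.Negative.Laminar
import Summits.AnomalousDissipation.AnomalousDissipation.Theorems.MomentParityQuarticGateSignLemma
import Summits.AnomalousDissipation.AnomalousDissipation.Theorems.MomentParityQuarticGateSurgery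
import Summits.AnomalousDissipation.AnomalousDissipation.Theorems.MomentParityQuarticGateStubOrder3SurgerySym
import Summits.AnomalousDissipation.AnomalousDissipation.Theorems.MomentParityQuarticGateStubOrder2DesignSym
import Summits.AnomalousDissipation.AnomalousDissipation.Theorems.MomentParityQuarticGateStubAxialDefect
import Summits.AnomalousDissipation.AnomalousDissipation.Theorems.MomentParityQuarticGateStubAxialQuadRigidity
import Summits.AnomalousDissipation.AnomalousDissipation.Theorems.MomentParityQuarticGateDefectCone
import Summits.AnomalousDissipation.AnomalousDissipation.Theorems.MomentParityQuarticGateLambdaPositivity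
import Literature.Analysis.FluidPDE.BeltramiWavesCurl

/-!
# Line `dissipative-tower`, ANNEX `dissipative_tower_core` — the lever `stub_noDissipativeTower` cut in
# two: a PURE-MATHLIB calculus core (moment amplification on `ℝ^ι`) and a frame DICTIONARY
# (crux `QuarticGate`, stmt-AnomalousDissipation-11464; strategist unit cstrat-stmt-AnomalousDissipation-11464-b1)

This file is NOT a rival line. It is the live line `Lines/dissipative_tower.lean` (strategist s3,
PICKED by lead c15 on 2026-08-17) with its only new-mathematics stub `stub_noDissipativeTower` (T)
DERIVED from two finer registered stubs, exactly as the landed sign lemma S1 was proved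
(`MomentParityQuarticGateSignLemmaCalculus.sum_fderiv_mul_eq_zero_of_div_free` = pure-Mathlib core on
`ι → ℝ`, then `MomentParityQuarticGateSignLemma.stub_signLemma` = frame dictionary):

* `stub_noTowerCalculus` (T-core, PURE MATHLIB, size M): on `ℝ^ι`, a `C¹` drift `V` that is divergence
  free and tangent to spheres, a linear "viscous" drift `c ↦ D c` coercive over a "Gram" form `P`
  (`κ ⟨P c, c⟩ ≤ ⟨c, -D c⟩`, `κ > 0`), a `C¹` observable `h` that is EULER-HOMOGENEOUS THROUGH `P`
  (`∑ₐ (P c)ₐ ∂ₐh = d·h`, `d ≥ 1`) and a CASIMIR of `V` (`∇h·V = 0`), and a `C¹` `q` with the TOWER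
  identity `∇q·V = ∇h·(D c)`. Then `h ≡ 0`.
  PROOF (moment amplification, all constants explicit). Fix `c₀`, a radial `C¹` bump `w ≥ 0`,
  `w c₀ = 1`, `∂_b w(c) = θ(c) c_b` with `θ ≤ 0` (the landed `exists_radial_bump` construction
  `w = smoothTransition (R+1-|c|²)`; add the two sign facts `0 ≤ w`, `θ ≤ 0` to its statement), and
  `m ≥ 1`; put `G = h^{2m} ≥ 0`, `I = ∫ G w ≥ 0`. Three coordinatewise integrations by parts
  (`integral_mul_fderiv_eq_neg_fderiv_mul_of_integrable`, everything continuous × compact support):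
  (a) with `F = h^{2m-1} q w`: `∑ₐ ∂ₐF·Vₐ = (2m-1)h^{2m-2}qw(∇h·V) + h^{2m-1}w(∇q·V) + h^{2m-1}qθ(c·V)
      = h^{2m-1} w ∇h·Dc` (Casimir, tower, tangency), and `∫ ∑ₐ ∂ₐF Vₐ = -∫ F div V = 0`; so
      `∫ w ∇G·Dc = 2m ∫ h^{2m-1} w ∇h·Dc = 0`.
  (b) `∫ w ∂ₐG (Dc)ₐ = -∫ G ∂ₐ(w (Dc)ₐ) = -∫ G (θ cₐ (Dc)ₐ + w D a a)`; summing over `a` and using (a):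
      `(-tr D) I = ∫ G θ ⟨c, Dc⟩ = ∫ G (-θ) ⟨c, -Dc⟩ ≥ κ ∫ G (-θ) ⟨Pc, c⟩` (pointwise: `G ≥ 0`, `-θ ≥ 0`,
      coercivity).
  (c) `∫ G(-θ)⟨Pc,c⟩ = -∫ G ∑ₐ (Pc)ₐ ∂ₐw = ∫ w ∑ₐ ∂ₐ(G (Pc)ₐ) = ∫ w (2m h^{2m-1} ∑ₐ(Pc)ₐ∂ₐh + G tr P)
      = (2md + tr P) I` (Euler through `P`).
  Hence `(-tr D) I ≥ κ (2md + tr P) I`; choosing `m` with `κ(2md + tr P) > -tr D` (possible: `κd > 0`)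
  gives `I ≤ 0`, so `I = 0`, so `G w ≡ 0` (continuous, `≥ 0`, zero integral), so `h(c₀)^{2m} = 0`.
  No symmetry / definiteness of `P` or `D` is used beyond the two displayed hypotheses; the `m = 1`
  instance of (b)–(c) is the classical INDEFINITE Gibbs identity — the even power is what gives a sign.
* `stub_noTowerDictionary` (T-dict, size M): the core statement implies T. Frame coordinates of the
  landed sign lemma (`exists_frame_synthesis` `U`, `G j a = (gⱼ, e_a)`, `T a b b'`, `h c = P(G c)`,
  `Vₐ c = ∑ c_b c_b' T a b b'`, `hrow`/`hkey`/`hdiv`/`htan` VERBATIM from `stub_signLemma`'s proof),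
  plus three new dictionary facts: (i) VISCOUS ROWS `nsGeneratorPairing ν 0 (U c) (e_a) = Vₐ c +
  ν (D c)ₐ` with `D a b = ∫⟪e_b, Δ e_a⟫ = -4π²|k_a|² Π a b`, `Π a b = ∫⟪e_a, e_b⟫` (definition of
  `nsGeneratorPairing` + `integral_inner_synthesis_left` + frame fields are Stokes eigenfields);
  (ii) COERCIVITY `4π² ⟨Πc,c⟩ = 4π²‖Uc‖² ≤ ‖∇(Uc)‖² = ⟨c,-Dc⟩` (Poincaré on mean-zero fields, `|k| ≥ 1`
  on the band; spectrally: `∑_{a,b} |k_a|² Π a b c_a c_b ≥ ∑_{a,b} Π a b c_a c_b` shell by shell, frame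
  fields of different shells being `L²`-orthogonal); (iii) EULER THROUGH `Π`:
  `∑ₐ (Πc)ₐ G j a = (gⱼ, ∑ₐ ⟨Uc,e_a⟩ e_a) = (gⱼ, P_N (U c)) = (gⱼ, U c) = (G c)ⱼ` (Parseval frame
  reconstruction `fourierTruncate_eq_sum_frameFieldIdx` + `U c` is level `N`), whence
  `∑ₐ (Πc)ₐ ∂ₐh = ∑ⱼ (Gc)ⱼ (∂ⱼP)(Gc) = 3 P(Gc)` (`MvPolynomial.IsHomogeneous.sum_X_mul_pderiv`). The tower
  hypothesis of T at `u = U c` reads `∇q̂·V = ν ∇h·(Dc)` (`hkey` for `(g',Q)`, linearity of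
  `nsGeneratorPairing` in the test, `eq_sum_frame_of_bandTest`, the Casimir hypothesis), i.e. the
  core's tower identity for `q̂/ν`; and `h ≡ 0` on `ℝ^A` transports to every level-`N` `u` through
  `c(u)ₐ = (u, e_a)` (step (5) of `stub_signLemma`).
* `stub_cubicRowSurgery` (S7) and `stub_rowCertificate` (S3″): VERBATIM the live line's (same
  registered rows).
* `noDissipativeTower` = T, DERIVED (modus ponens) — its statement is byte-identical to the live line's
  `stub_noDissipativeTower`, so a proof of the two finer stubs closes the live line's T as well;
  `QuarticGate_of`: VERBATIM the live line's composition with T so derived; concludes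
  `Theses.QuarticLadder.QuarticGate` BY NAME (and `Theses.MomentParity.QuarticGate`, defeq).

Registry: the two new stubs are registered with `workitem stub-add` ONLY (no `skeleton check`: the
lead's registration of `Lines/dissipative_tower.lean` stays THE skeleton of the crux).
-/

namespace Summit.AnomalousDissipation.AnomalousDissipation.Cruxes.QuarticGate.DissipativeTowerCore

open MeasureTheory Filter
open Literature.Analysis.FunctionSpaces Literature.Analysis.FluidPDE
open Summit.AnomalousDissipation.AnomalousDissipation.Theorems.QuarticGate.Negative
open Summit.AnomalousDissipation.AnomalousDissipation.Theorems

set_option linter.dupNamespace false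

/-! ## T cut in two -/

/-- **T-core — NO DISSIPATIVE TOWER, the finite-dimensional calculus step (pure Mathlib).**
On `ℝ^ι`: `V` a `C¹` drift, divergence free (`∑ₐ ∂ₐVₐ ≡ 0`) and tangent to spheres (`∑ₐ cₐ Vₐ(c) = 0`);
`D`, `P` real matrices with the coercivity `κ ∑_{a,b} P a b cₐ c_b ≤ -∑_{a,b} D a b cₐ c_b` (`κ > 0`);
`h` a `C¹` observable, Euler-homogeneous of degree `d ≥ 1` through `P` (`∑ₐ (P c)ₐ ∂ₐh(c) = d h(c)`)
and a Casimir of `V` (`∑ₐ ∂ₐh Vₐ = 0`); `q` a `C¹` observable with the TOWER identity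
`∑ₐ ∂ₐq Vₐ = ∑ₐ ∂ₐh (D c)ₐ`. Then `h ≡ 0`. Proof: moment amplification (file docstring (a)–(c)):
`(-tr D) ∫ h^{2m} w ≥ κ (2md + tr P) ∫ h^{2m} w` for a radial decreasing `C¹` bump `w` and every
`m ≥ 1`. Size M; template `MomentParityQuarticGateSignLemmaCalculus`. [folklore-new] -/
theorem stub_noTowerCalculus :
    ∀ {ι : Type} [Fintype ι] [DecidableEq ι] (h q : (ι → ℝ) → ℝ) (V : ι → (ι → ℝ) → ℝ)
      (D P : ι → ι → ℝ) (κ : ℝ) (d : ℕ),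
      ContDiff ℝ 1 h → ContDiff ℝ 1 q → (∀ a, ContDiff ℝ 1 (V a)) →
      (∀ c, ∑ a, fderiv ℝ (V a) c (Pi.single a 1) = 0) →
      (∀ c : ι → ℝ, ∑ a, c a * V a c = 0) →
      0 < κ → 1 ≤ d →
      (∀ c : ι → ℝ, κ * ∑ a, ∑ b, P a b * c a * c b ≤ -∑ a, ∑ b, D a b * c a * c b) →
      (∀ c : ι → ℝ, ∑ a, (∑ b, P a b * c b) * fderiv ℝ h c (Pi.single a 1) = (d : ℝ) * h c) →
      (∀ c, ∑ a, fderiv ℝ h c (Pi.single a 1) * V a c = 0) →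
      (∀ c : ι → ℝ, ∑ a, fderiv ℝ q c (Pi.single a 1) * V a c =
        ∑ a, fderiv ℝ h c (Pi.single a 1) * ∑ b, D a b * c b) →
      ∀ c, h c = 0 := by
  sorry

/-- **T-dict — the frame dictionary: the calculus core implies `stub_noDissipativeTower`.**
In the frame coordinates of the landed sign lemma (`exists_frame_synthesis`, `frameFieldIdx_band`,
`fderiv_eval_linear`, `fderiv_quadratic`; `hrow`, `hkey`, `hdiv`, `htan` verbatim from the proof of
`stub_signLemma`) with, in addition, the viscous rows `nsGeneratorPairing ν 0 (U c) (e_a) = Vₐ c +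
ν ∑_b D a b c_b`, `D a b = ∫⟪e_b, Δe_a⟫`, the coercivity `4π² ∑ Π a b cₐ c_b ≤ -∑ D a b cₐ c_b`
(Poincaré, `Π` the Gram matrix of the frame) and Euler's identity through `Π` (Parseval reconstruction
of the band tests + `MvPolynomial.IsHomogeneous.sum_X_mul_pderiv`), the hypotheses of T are the
hypotheses of the core at `(h, q/ν, V, D, Π, 4π², 3)`, and `h ≡ 0` transports to level-`N` fields.
Size M. [folklore] -/
theorem stub_noTowerDictionary :
    (∀ {ι : Type} [Fintype ι] [DecidableEq ι] (h q : (ι → ℝ) → ℝ) (V : ι → (ι → ℝ) → ℝ)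
      (D P : ι → ι → ℝ) (κ : ℝ) (d : ℕ),
      ContDiff ℝ 1 h → ContDiff ℝ 1 q → (∀ a, ContDiff ℝ 1 (V a)) →
      (∀ c, ∑ a, fderiv ℝ (V a) c (Pi.single a 1) = 0) →
      (∀ c : ι → ℝ, ∑ a, c a * V a c = 0) →
      0 < κ → 1 ≤ d →
      (∀ c : ι → ℝ, κ * ∑ a, ∑ b, P a b * c a * c b ≤ -∑ a, ∑ b, D a b * c a * c b) →
      (∀ c : ι → ℝ, ∑ a, (∑ b, P a b * c b) * fderiv ℝ h c (Pi.single a 1) = (d : ℝ) * h c) →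
      (∀ c, ∑ a, fderiv ℝ h c (Pi.single a 1) * V a c = 0) →
      (∀ c : ι → ℝ, ∑ a, fderiv ℝ q c (Pi.single a 1) * V a c =
        ∑ a, fderiv ℝ h c (Pi.single a 1) * ∑ b, D a b * c b) →
      ∀ c, h c = 0) →
    ∀ (N : ℕ) (ν : ℝ), ν ≠ 0 →
    ∀ (m : ℕ) (g : Fin m → UnitAddTorus (Fin 3) → EuclideanSpace ℝ (Fin 3))
      (P : MvPolynomial (Fin m) ℝ), (∀ i, IsBandTest N (g i)) → P.IsHomogeneous 3 →
      (∀ u : Torus.energySpace (Fin 3), IsLevel N u →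
        Torus.nsGeneratorPairing (d := Fin 3) 0 0 u (polyGrad g P u) = 0) →
    ∀ (m' : ℕ) (g' : Fin m' → UnitAddTorus (Fin 3) → EuclideanSpace ℝ (Fin 3))
      (Q : MvPolynomial (Fin m') ℝ), (∀ i, IsBandTest N (g' i)) →
      (∀ u : Torus.energySpace (Fin 3), IsLevel N u →
        Torus.nsGeneratorPairing (d := Fin 3) 0 0 u (polyGrad g' Q u) =
          Torus.nsGeneratorPairing (d := Fin 3) ν 0 u (polyGrad g P u)) →
    ∀ u : Torus.energySpace (Fin 3), IsLevel N u →
      MvPolynomial.eval (fun j => Torus.pairing u.1 (g j)) P = 0 := by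
  sorry

/-- **T — NO DISSIPATIVE TOWER over a cubic Casimir**, DERIVED from the two stubs above (modus ponens).
Statement byte-identical to `stub_noDissipativeTower` of the live line `Lines/dissipative_tower.lean`. -/
theorem noDissipativeTower :
    ∀ (N : ℕ) (ν : ℝ), ν ≠ 0 →
    ∀ (m : ℕ) (g : Fin m → UnitAddTorus (Fin 3) → EuclideanSpace ℝ (Fin 3))
      (P : MvPolynomial (Fin m) ℝ), (∀ i, IsBandTest N (g i)) → P.IsHomogeneous 3 →
      (∀ u : Torus.energySpace (Fin 3), IsLevel N u →
        Torus.nsGeneratorPairing (d := Fin 3) 0 0 u (polyGrad g P u) = 0) →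
    ∀ (m' : ℕ) (g' : Fin m' → UnitAddTorus (Fin 3) → EuclideanSpace ℝ (Fin 3))
      (Q : MvPolynomial (Fin m') ℝ), (∀ i, IsBandTest N (g' i)) →
      (∀ u : Torus.energySpace (Fin 3), IsLevel N u →
        Torus.nsGeneratorPairing (d := Fin 3) 0 0 u (polyGrad g' Q u) =
          Torus.nsGeneratorPairing (d := Fin 3) ν 0 u (polyGrad g P u)) →
    ∀ u : Torus.energySpace (Fin 3), IsLevel N u →
      MvPolynomial.eval (fun j => Torus.pairing u.1 (g j)) P = 0 :=
  stub_noTowerDictionary (fun h q V D P κ d => stub_noTowerCalculus h q V D P κ d)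

/-! ## S7 and S3″ — VERBATIM the live line `Lines/dissipative_tower.lean` (same registered rows) -/

/-- **S7 — CUBIC-ROW SURGERY: a second third-moment shift kills the row of every cubic Casimir.**
Let `μ₁` be a level-`N` probability law with finite fourth moments, SLATER at degree `4`, 3-STATIONARY
for Galerkin NS at `(ν, f, N)` (`f` smooth, `ν ≠ 0`) — the output of the landed S5b — at a level where
T's conclusion holds (hypothesis, verbatim shape of `stub_noDissipativeTower` at `(N, ν)`). Then there is
a level-`N` probability law `μ₂` with finite fourth moments, Slater at degree `4`, 3-stationary, with the
SAME mean energy and dissipation, such that additionally `∫ row dμ₂ = 0` (integrable) for every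
homogeneous cubic band observable that is a Casimir of level-`N` Galerkin–Euler.
Why true: in an orthonormal band basis `b` (`exists_bandBasis`) let `y = (1, M₁, M₂, M₃, M₄)` be the
coordinate moments of `μ₁` (finite: `‖u‖⁴` integrable), `W₃ ⊇ Cas₃` the homogeneous cubics and the cubic
Casimirs (a finite-dimensional subspace: kernel of `P ↦ {p,B_N}` in coordinates, `exists_rowPoly` with
`ν = 0, f = 0`). For `C ∈ Cas₃`, `row(C) = L_y(R_C)` with `R_C = (X_f C)₂ + ν (X_Δ C)₃` of degree `≤ 3`
(no quartic part). Seek a shift `S` of the degree-3 entries with (i) `⟨(R_Q)₃, S⟩ = 0` for every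
homogeneous QUADRATIC basis test `Q` (so all rows of degree-`≤ 2` observables are unchanged: still `0`)
and (ii) `ν⟨(X_Δ Cᵢ)₃, S⟩ = -row(Cᵢ)` on a basis `Cᵢ` of `Cas₃`. By finite-dimensional duality
(`exists_eq_sum_mul_of_forall_sum_eq_zero`, QuadRange) the system is solvable unless a relation
`Σ p_Q (R_Q)₃ + Σ aᵢ ν (X_Δ Cᵢ)₃ = 0` has `a ≠ 0`, i.e. unless `{q, B_N} = ν X_Δ C` on `V_N` for
`q = ∓Σ p_Q Q` and the Casimir `C = Σ aᵢ Cᵢ ≠ 0` — excluded by the hypothesis (T). Then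
`y' = (1, M₁, M₂, M₃ + S, Λ'·M₄)` is strictly positive for `Λ'` large
(`exists_forall_le_isStrictlyKPositive_shift`: `y` is strictly positive in degree 4 by Slater), REALIZE
it (`exists_measure_of_strictlyKPositive`, `exists_level_of_coords`) as `μ₂`; rows of degree `≤ 2` tests,
energy and dissipation are Riesz functionals of degree-`≤ 3` polynomials whose `S`-pairing vanishes or
of degree-`≤ 2` polynomials (unchanged), and `row_{μ₂}(Cᵢ) = row_{μ₁}(Cᵢ) + ν⟨(X_Δ Cᵢ)₃, S⟩ = 0`.
Size M–L (the landed Kernel/Assembly files of S5, `exists_shifted_sequence_of_casimirRows` /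
`order3Surgery_of_casimirRows` as templates). [folklore] -/
theorem stub_cubicRowSurgery :
    ∀ (ν : ℝ) (f : UnitAddTorus (Fin 3) → EuclideanSpace ℝ (Fin 3)) (N : ℕ)
      (μ₁ : Measure (Torus.energySpace (Fin 3))),
    ν ≠ 0 → Torus.IsSmooth f →
    IsProbabilityMeasure μ₁ → (∀ᵐ u ∂μ₁, IsLevel N u) →
    Integrable (fun u : Torus.energySpace (Fin 3) => ‖u‖ ^ 4) μ₁ →
    (∀ (m : ℕ) (g : Fin m → UnitAddTorus (Fin 3) → EuclideanSpace ℝ (Fin 3))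
      (P : MvPolynomial (Fin m) ℝ), (∀ i, IsBandTest N (g i)) → P.totalDegree ≤ 4 →
      (∀ u : Torus.energySpace (Fin 3), IsLevel N u →
        0 ≤ MvPolynomial.eval (fun j => Torus.pairing u.1 (g j)) P) →
      (∃ u : Torus.energySpace (Fin 3), IsLevel N u ∧
        MvPolynomial.eval (fun j => Torus.pairing u.1 (g j)) P ≠ 0) →
      0 < ∫ u, MvPolynomial.eval (fun j => Torus.pairing u.1 (g j)) P ∂μ₁) →
    IsPolyStationary ν f N 3 μ₁ →
    (∀ (m : ℕ) (g : Fin m → UnitAddTorus (Fin 3) → EuclideanSpace ℝ (Fin 3))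
      (P : MvPolynomial (Fin m) ℝ), (∀ i, IsBandTest N (g i)) → P.IsHomogeneous 3 →
      (∀ u : Torus.energySpace (Fin 3), IsLevel N u →
        Torus.nsGeneratorPairing (d := Fin 3) 0 0 u (polyGrad g P u) = 0) →
      ∀ (m' : ℕ) (g' : Fin m' → UnitAddTorus (Fin 3) → EuclideanSpace ℝ (Fin 3))
        (Q : MvPolynomial (Fin m') ℝ), (∀ i, IsBandTest N (g' i)) →
        (∀ u : Torus.energySpace (Fin 3), IsLevel N u →
          Torus.nsGeneratorPairing (d := Fin 3) 0 0 u (polyGrad g' Q u) =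
            Torus.nsGeneratorPairing (d := Fin 3) ν 0 u (polyGrad g P u)) →
      ∀ u : Torus.energySpace (Fin 3), IsLevel N u →
        MvPolynomial.eval (fun j => Torus.pairing u.1 (g j)) P = 0) →
    ∃ μ₂ : Measure (Torus.energySpace (Fin 3)), IsProbabilityMeasure μ₂ ∧ (∀ᵐ u ∂μ₂, IsLevel N u) ∧
      Integrable (fun u : Torus.energySpace (Fin 3) => ‖u‖ ^ 4) μ₂ ∧
      (∀ (m : ℕ) (g : Fin m → UnitAddTorus (Fin 3) → EuclideanSpace ℝ (Fin 3))
        (P : MvPolynomial (Fin m) ℝ), (∀ i, IsBandTest N (g i)) → P.totalDegree ≤ 4 →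
        (∀ u : Torus.energySpace (Fin 3), IsLevel N u →
          0 ≤ MvPolynomial.eval (fun j => Torus.pairing u.1 (g j)) P) →
        (∃ u : Torus.energySpace (Fin 3), IsLevel N u ∧
          MvPolynomial.eval (fun j => Torus.pairing u.1 (g j)) P ≠ 0) →
        0 < ∫ u, MvPolynomial.eval (fun j => Torus.pairing u.1 (g j)) P ∂μ₂) ∧
      IsPolyStationary ν f N 3 μ₂ ∧
      (∀ (m : ℕ) (g : Fin m → UnitAddTorus (Fin 3) → EuclideanSpace ℝ (Fin 3))
        (P : MvPolynomial (Fin m) ℝ), (∀ i, IsBandTest N (g i)) → P.IsHomogeneous 3 →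
        (∀ u : Torus.energySpace (Fin 3), IsLevel N u →
          Torus.nsGeneratorPairing (d := Fin 3) 0 0 u (polyGrad g P u) = 0) →
        Integrable (fun u : Torus.energySpace (Fin 3) =>
          Torus.nsGeneratorPairing ν f u (polyGrad g P u)) μ₂ ∧
        ∫ u, Torus.nsGeneratorPairing ν f u (polyGrad g P u) ∂μ₂ = 0) ∧
      Torus.ensembleEnergy μ₂ = Torus.ensembleEnergy μ₁ ∧
      Torus.ensembleDissipation ν μ₂ = Torus.ensembleDissipation ν μ₁ := by
  sorry

/-- **S3″ — DEFECT CERTIFICATE FROM VANISHING CASIMIR ROWS (no symmetry, no Casimir hypothesis).**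
For a smooth force `f`, a level-`N` probability law `μ` with finite fourth moments whose row
`∫ nsGeneratorPairing ν f u (∇p(u)) dμ` vanishes on every homogeneous cubic band observable `p` that is
a Casimir of level-`N` Galerkin–Euler, there are finitely many level-`N` fields `vₗ` and weights
`cₗ ≥ 0` with `row_μ(p₃) + Σₗ cₗ {p₃,B_N}(vₗ) = 0` for EVERY homogeneous cubic band test `p₃` — the
plain certificate shape consumed by the landed surgery S4 (`MomentParityQuarticGate.stub_surgery`).
Why true: transport every cubic band test to an orthonormal band basis (`exists_bandBasis`,
`polyGrad_transport`), `W :=` homogeneous cubics in `n` variables; the row `ψ` and the Euler-derivative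
evaluations `ev_v` are linear functionals on `W` (`AxialCert.integrable_and_exists_cubicRowFunctional`,
`AxialCert.exists_pointRowFunctional`, landed); apply the landed abstract cone lemma
`exists_conic_certificate` to `(ev, ψ)`: its hypothesis "`ev_v P ≥ 0 ∀ v ⟹ ψ P = 0 ∧ ev_v P = 0 ∀ v`"
holds because `{p,B_N} ≥ 0` on `V_N` forces `{p,B_N} ≡ 0` (sign lemma `stub_signLemma`, S1 LANDED),
i.e. `p` is a cubic Casimir, on which `ψ` vanishes BY HYPOTHESIS. (Equivalently: `cone{ev_v}` is the
whole annihilator `Cas₃^⊥`.) Size S–M. Not an instance of `Negative/DefectCertificateCasimir`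
(p82008), which drops the Casimir information altogether. [folklore] -/
theorem stub_rowCertificate :
    ∀ (N : ℕ) (ν : ℝ) (f : UnitAddTorus (Fin 3) → EuclideanSpace ℝ (Fin 3)), Torus.IsSmooth f →
    ∀ μ : Measure (Torus.energySpace (Fin 3)), IsProbabilityMeasure μ → (∀ᵐ u ∂μ, IsLevel N u) →
    Integrable (fun u : Torus.energySpace (Fin 3) => ‖u‖ ^ 4) μ →
    (∀ (m : ℕ) (g : Fin m → UnitAddTorus (Fin 3) → EuclideanSpace ℝ (Fin 3))
      (P : MvPolynomial (Fin m) ℝ), (∀ i, IsBandTest N (g i)) → P.IsHomogeneous 3 →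
      (∀ u : Torus.energySpace (Fin 3), IsLevel N u →
        Torus.nsGeneratorPairing (d := Fin 3) 0 0 u (polyGrad g P u) = 0) →
      ∫ u, Torus.nsGeneratorPairing ν f u (polyGrad g P u) ∂μ = 0) →
    ∃ (M : ℕ) (v : Fin M → Torus.energySpace (Fin 3)) (c : Fin M → ℝ),
      (∀ l, IsLevel N (v l)) ∧ (∀ l, 0 ≤ c l) ∧
      ∀ (m : ℕ) (g : Fin m → UnitAddTorus (Fin 3) → EuclideanSpace ℝ (Fin 3))
        (P : MvPolynomial (Fin m) ℝ), (∀ i, IsBandTest N (g i)) → P.IsHomogeneous 3 →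
        ∫ u, Torus.nsGeneratorPairing ν f u (polyGrad g P u) ∂μ +
          ∑ l, c l * Torus.nsGeneratorPairing (d := Fin 3) 0 0 (v l) (polyGrad g P (v l)) = 0 := by
  sorry

/-! ## The composition (kernel-checked, no `sorry` of its own) -/

/-- **`QuarticGate` from the four stubs (T derived as `noDissipativeTower`) and the landed order-≤3 tier — VERBATIM the live composition.** Take `f, E, ε, ν₀` from the
landed symmetric order-2 design S6′ and `ν_j := ν₀/(j+2)` (positive, `< ν₀`, `→ 0`). At each `j`, S6′
gives `N₀`; for EVERY `N ≥ max(N₀, 2)` (eventually, hence frequently, in `N`), with `L := 2N + 1`: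
S6′ gives the symmetric loud order-2 design `μ₀`; S2q + S5a (landed) kill every quadratic Casimir row;
S5b (landed) gives a Slater 3-stationary `μ₁` with the same energy/dissipation; S7 (fed T at `(N, ν_j)`)
re-shifts it to `μ₂` with all cubic-Casimir rows zero; S3″ turns that into a plain defect certificate;
S4 (landed) performs the far-atom surgery: a level-`N` 4-stationary law with energy `≤ E` and
dissipation `≥ ε`. -/
theorem QuarticGate_of :
    Summit.AnomalousDissipation.AnomalousDissipation.Theses.QuarticLadder.QuarticGate := by
  obtain ⟨f, hfs, hfd, hfz, hfsym, E, ε, ν₀, hε, hν₀, hK1⟩ :=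
    MomentParityQuarticGate.stub_order2DesignSym
  have hνpos : ∀ j : ℕ, 0 < ν₀ / ((j : ℝ) + 2) := fun j => div_pos hν₀ (by positivity)
  have hνlt : ∀ j : ℕ, ν₀ / ((j : ℝ) + 2) < ν₀ := fun j => by
    rw [div_lt_iff₀ (by positivity)]
    nlinarith [(Nat.cast_nonneg j : (0 : ℝ) ≤ j)]
  have hνlim : Tendsto (fun j : ℕ => ν₀ / ((j : ℝ) + 2)) atTop (nhds 0) :=
    tendsto_const_nhds.div_atTop
      (tendsto_atTop_add_const_right atTop (2 : ℝ) tendsto_natCast_atTop_atTop)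
  refine ⟨f, hfs, hfd, hfz, fun j => ν₀ / ((j : ℝ) + 2), E, ε, hνpos, hνlim, hε, fun j => ?_⟩
  obtain ⟨N₀, hN₀⟩ := hK1 _ (hνpos j) (hνlt j)
  refine Filter.Eventually.frequently ?_
  filter_upwards [eventually_ge_atTop N₀, eventually_ge_atTop 2] with N hN h2
  obtain ⟨μ₀, hp₀, hl₀, hR₀, hnd₀, hsym₀, hlin₀, hErow₀, hHrow₀, hE₀, hD₀⟩ :=
    hN₀ N hN (2 * N + 1) (Nat.succ_pos _)
  have hQuad := MomentParityQuarticGate.stub_axialQuadRigidity N h2 (2 * N + 1) (by omega)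
  have hCas := MomentParityQuarticGate.stub_axialDefect _ f N (2 * N + 1) μ₀ hfs hfsym (by omega)
    hp₀ hl₀ hR₀ hsym₀ hErow₀ hHrow₀ hQuad
  obtain ⟨μ₁, hp₁, hl₁, hi₁, hsl₁, hst₁, -, hE₁, hD₁⟩ :=
    MomentParityQuarticGate.stub_order3SurgerySym _ f N (2 * N + 1) μ₀ hfs hfsym (Nat.succ_pos _)
      hp₀ hl₀ hR₀ hnd₀ hsym₀ hlin₀ (fun m g P hg hP hC => (hCas m g P hg hP hC).2)
  have hT := noDissipativeTower N (ν₀ / ((j : ℝ) + 2)) (hνpos j).ne'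
  obtain ⟨μ₂, hp₂, hl₂, hi₂, hsl₂, hst₂, hrow₂, hE₂, hD₂⟩ :=
    stub_cubicRowSurgery _ f N μ₁ (hνpos j).ne' hfs hp₁ hl₁ hi₁ hsl₁ hst₁ hT
  obtain ⟨M, v, c, hcert⟩ :=
    stub_rowCertificate N _ f hfs μ₂ hp₂ hl₂ hi₂ (fun m g P hg hP hC => (hrow₂ m g P hg hP hC).2)
  obtain ⟨μ, hp, hl, hi, hst, hE, hD⟩ :=
    MomentParityQuarticGate.stub_surgery _ f N μ₂ hfs hp₂ hl₂ hi₂ hsl₂ hst₂ M v c hcert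
  refine ⟨μ, hp, hl, hi, hst, ?_, ?_⟩
  · rw [hE, hE₂, hE₁]; exact hE₀
  · rw [hD, hD₂, hD₁]; exact hD₀

/-- The same theorem under the `MomentParity` name of the shared crux (the two route decls are
verbatim copies; definitional unfolding). -/
theorem QuarticGate_of_momentParity :
    Summit.AnomalousDissipation.AnomalousDissipation.Theses.MomentParity.QuarticGate :=
  QuarticGate_of

end Summit.AnomalousDissipation.AnomalousDissipation.Cruxes.QuarticGate.DissipativeTowerCore
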